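import Summits.Ventures.YMGap.RobustBall.EnergyVarianceDLR
import Summits.Ventures.YMGap.RobustBall.UniformPlaquetteVarianceFloor
import HarnessLib

/-!
# Robust ball (Y2) — the extensive energy-variance floor UNIFORMLY ON THE TIER-1 BALL: every member, every DLR state, every coupling

HONEST FRAMING: venture file of the cell `pub-ymgap` (QuantumFields programme), track ROBUST-BALL, seat rb-p2 (g8).  LATTICE statement about
the DLR states `μ ∈ perturbedGibbsMeasures (fundamentalRep (Fin N)) (Nβ) W supp` of EVERY member `(W, supp)` of the tier-1 `ℤ^d` ball
`MemBallZd ε₀ ε₁ R` (rb-theory's typed object: the Wilson action at 't Hooft coupling `β` plus a finite-range link potential of oscillation load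
`≤ ε₀` per link), at EVERY real `β`, with NO smallness assumption on `ε₀, ε₁` (no door): the fluctuations of the plaquette energy over any family
of pairwise separated links are extensive from below.  This is the uniform-on-the-ball companion of `EnergyVarianceDLR` (the Wilson point,
`ε₀ = 0`) and the extensive companion of rb-p1's single-plaquette floor `UniformPlaquetteVarianceFloor.variance_plaquette_ge_of_memBallZd`.
Nothing about the continuum, a spectral gap or Clay.

THE THEOREM (`card_mul_le_variance_plaquetteSum_of_memBallZd`).  `d ≥ 2`, `N ≥ 2`, `(W, supp) ∈ MemBallZd ε₀ ε₁ R`, `μ` a DLR state of the member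
at 't Hooft coupling `β`; `F` a finite set of links such that for `e ≠ e'` in `F`, `e'` is not in the range `perturbedNbr supp e` of the one-link law
at `e` (no common plaquette, no common interaction set); `P ⊇` the plaquettes through `F`.  Then

  `|F| · e^{−2(4(d−1)N²|β| + ε₀)} · V₀ ≤ Var_μ(Σ_{p∈P} Re tr U_p)`,   `V₀ = charVariance (fundamentalRep (Fin N))`.

MECHANISM: the inverse Efron–Stein inequality (`EnergyVarianceBessel`) for the member's one-link kernels (rb-p1's `PerturbedOneLink`:
`siteLaw_perturbedYM_eq_tilted_haar`, finite range `siteLaw_perturbedYM_congr`, oscillation `perturbedEnergy_singleton_osc`), the abstract density-floor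
lemmas of `EnergyVarianceDLRKernel`, and the `ℤ^d` fibre computation `charVariance_le_integral_fibreVariance_zd` of `EnergyVarianceDLR` (it concerns the
observable only, so it is the same for every member).  Everything here is proved. [folklore]
-/

noncomputable section

open MeasureTheory ProbabilityTheory Finset Function
open Literature.MathematicalPhysics.QuantumFieldTheory.Balaban1983to89.T4DobrushinTensorisation
open Literature.MathematicalPhysics.QuantumFieldTheory.Balaban1983to89.T4CouplingChain (integrable_of_abs_le_const)
open Literature.Probability.LatticeModels Literature.Probability.LatticeModels.DobrushinMetric
open Literature.MathematicalPhysics.QuantumLattice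
open Literature.MathematicalPhysics.QuantumFieldTheory hiding ZdEdge

namespace Summit.Ventures.YMGap.RobustBall

namespace EnergyVariance

variable {d N : ℕ} {ε₀ ε₁ R : ℝ} {W : Potential (ZdEdge d) (SUN N)} {supp : Finset (ZdEdge d) → Finset (Finset (ZdEdge d))}

/-- The member's one-link law `U ↦ siteLaw (perturbedYM ρ (Nβ) W supp) e U` is a measurable (kernel) map. [folklore] -/
theorem measurable_siteLaw_perturbedYM (hW : MemBallZd ε₀ ε₁ R W supp) (β : ℝ) (e : ZdEdge d) :
    Measurable fun U : LGConfig d (SUN N) => siteLaw (perturbedYM (fundamentalRep (Fin N)) (N * β) W supp) e U := by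
  haveI : SecondCountableTopology (Matrix (Fin N) (Fin N) ℂ) := inferInstanceAs (SecondCountableTopology (Fin N → Fin N → ℂ))
  haveI : SecondCountableTopology (SUN N) := Topology.IsEmbedding.subtypeVal.secondCountableTopology
  have hWa : W.IsAdapted := fun X => ⟨hW.dependsOn X, (hW.continuous X).measurable⟩
  have hWb : ∀ X, ∃ C, ∀ U, |W X U| ≤ C := fun X => exists_bound_of_continuous (hW.continuous X)
  have hγ := isSpecification_perturbedYM (d := d) (fundamentalRep (Fin N)) (continuous_fundamentalRep (Fin N)) (N * β) hWa hWb hW.supportedBy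
  exact (Measure.measurable_map _ (measurable_pi_apply e)).comp (hγ.measurable_fun {e})

/-- ★★ **THE EXTENSIVE ENERGY-VARIANCE FLOOR, UNIFORMLY ON THE TIER-1 BALL, at every coupling.**  `d ≥ 2`, `N ≥ 2`, `(W, supp) ∈ MemBallZd ε₀ ε₁ R`,
`μ` ANY DLR state of the member at 't Hooft coupling `β`; `F` a finite set of links pairwise outside each other's one-link range `perturbedNbr supp`;
`P ⊇` the plaquettes through `F`.  Then
`|F| · e^{−2(4(d−1)N²|β| + ε₀)} · V₀ ≤ ∫ (Σ_{p∈P} Re tr U_p − ⟨Σ_{p∈P} Re tr U_p⟩_μ)² dμ`. [folklore] -/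
theorem card_mul_le_variance_plaquetteSum_of_memBallZd (hd : 2 ≤ d) (hN : 2 ≤ N) (hW : MemBallZd ε₀ ε₁ R W supp) {β : ℝ}
    {μ : Measure (LGConfig d (SUN N))} (hμ : μ ∈ perturbedGibbsMeasures (d := d) (fundamentalRep (Fin N)) (N * β) W supp)
    (F : Finset (ZdEdge d)) (hF : ∀ e ∈ F, ∀ e' ∈ F, e ≠ e' → e' ∉ perturbedNbr supp e)
    (P : Finset (ZdPlaquette d)) (hP : ∀ e ∈ F, plaquettesTouching {e} ⊆ P) :
    (F.card : ℝ) * Real.exp (-(2 * (4 * ((d : ℝ) - 1) * (N : ℝ) ^ 2 * |β| + ε₀))) *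
        PlaquetteLowerBound.charVariance (fundamentalRep (Fin N)) ≤
      ∫ U, ((∑ p ∈ P, plaquetteObs (fundamentalRep (Fin N)) p.1 p.2.1.1 p.2.1.2 U) -
        ∫ V, ∑ p ∈ P, plaquetteObs (fundamentalRep (Fin N)) p.1 p.2.1.1 p.2.1.2 V ∂μ) ^ 2 ∂μ := by
  classical
  haveI : SecondCountableTopology (Matrix (Fin N) (Fin N) ℂ) := inferInstanceAs (SecondCountableTopology (Fin N → Fin N → ℂ))
  haveI : SecondCountableTopology (SUN N) := Topology.IsEmbedding.subtypeVal.secondCountableTopology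
  set ρ : SUN N →* Matrix (Fin N) (Fin N) ℂ := fundamentalRep (Fin N) with hρdef
  have hρ : IsSpecialUnitaryModel ρ := TorusAreaLaw.isSpecialUnitaryModel_fundamentalRep N
  have hρc : Continuous ρ := hρ.1
  have hρu := IsSpecialUnitaryModel.mem_unitaryGroup ρ hρ
  have hd1 : 1 ≤ d := by omega
  have hWm : ∀ X, Measurable (W X) := fun X => (hW.continuous X).measurable
  have hWa : W.IsAdapted := fun X => ⟨hW.dependsOn X, hWm X⟩
  have hWb : ∀ X, ∃ C, ∀ U, |W X U| ≤ C := fun X => exists_bound_of_continuous (hW.continuous X)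
  set γ := perturbedYM (d := d) ρ (N * β) W supp with hγdef
  have hγ : IsSpecification γ := isSpecification_perturbedYM (d := d) ρ hρc (N * β) hWa hWb hW.supportedBy
  have hμ' : IsGibbsMeasure γ μ := hμ
  haveI := hμ'.isProbabilityMeasure
  set D : ℝ := 4 * ((d : ℝ) - 1) * (N : ℝ) ^ 2 * |β| + ε₀ with hD
  -- the one-link kernels of the member
  set q : (e : ZdEdge d) → Kernel (LGConfig d (SUN N)) (SUN N) := fun e =>
    ⟨fun U => siteLaw γ e U, measurable_siteLaw_perturbedYM hW β e⟩ with hq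
  have hqapp : ∀ e U, q e U = siteLaw γ e U := fun e U => rfl
  haveI : ∀ e, IsMarkovKernel (q e) := fun e => ⟨fun U => by rw [hqapp]; exact isProbabilityMeasure_siteLaw hγ e U⟩
  -- locality in the resampled link and in separated links
  have hcongr : ∀ (e e' : ZdEdge d), (e' = e ∨ e' ∉ perturbedNbr supp e) → ∀ (U : LGConfig d (SUN N)) (y : SUN N),
      q e (update U e' y) = q e U := by
    intro e e' h U y
    rw [hqapp, hqapp]
    refine siteLaw_perturbedYM_congr ρ hρc (N * β) hWa supp e fun z hz => ?_
    have hze' : z ≠ e' := by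
      intro hze'
      rw [hze'] at hz
      rcases h with h | h
      · rw [h] at hz
        exact not_mem_perturbedNbr supp e hz
      · exact h hz
    exact update_of_ne hze' y U
  have hloc : ∀ (e : ZdEdge d) (U : LGConfig d (SUN N)) (y : SUN N), q e (update U e y) = q e U :=
    fun e U y => hcongr e e (Or.inl rfl) U y
  -- DLR at one link = resampling invariance
  have hinv : ResamplingInvariant μ q := by
    intro e Φ B hΦm hΦB
    have h1 : (fun U : LGConfig d (SUN N) => ∫ y, Φ (update U e y) ∂(q e U)) = fun U => ∫ σ, Φ σ ∂(γ {e} U) := by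
      funext U
      rw [hqapp, ← siteAvg_eq_integral_siteLaw hγ e hΦm U]
      rfl
    rw [h1]
    exact hμ'.integral_integral_eq hγ {e} (integrable_of_abs_le' hΦm hΦB)
  -- the density floor of every one-link law of the member
  have hfloor : ∀ (e : ZdEdge d) (U : LGConfig d (SUN N)) (g : SUN N → ℝ) (B : ℝ), Measurable g → (∀ y, 0 ≤ g y) → (∀ y, |g y| ≤ B) →
      Real.exp (-D) * ∫ y, g y ∂haarProbability (SUN N) ≤ ∫ y, g y ∂(q e U) := by
    intro e U g B hgm hg0 hgB
    rw [hqapp, siteLaw_perturbedYM_eq_tilted_haar ρ hρc (N * β) hWm supp e U]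
    set φ : SUN N → ℝ := fun y => perturbedEnergy ρ (N * β) W supp {e} (update U e y) with hφ
    have hφm : Measurable φ := (measurable_perturbedEnergy ρ hρc (N * β) hWm supp {e}).comp (measurable_update U)
    obtain ⟨lo, hlo⟩ := exists_window_of_osc (1 : SUN N) (V := φ) (a := D)
      (fun y y' => perturbedEnergy_singleton_osc hd1 hW e U y y')
    exact PlaquettePositivity.exp_neg_mul_integral_le_integral_tilted (ν := haarProbability (SUN N)) hgm hg0
      (fun y => (le_abs_self _).trans (hgB y)) hφm (a := lo) (D := D) (ae_of_all _ fun y => hlo y)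
  -- separation: no common plaquette
  have hsepP : ∀ e ∈ F, ∀ e' ∈ F, e ≠ e' → ∀ p : ZdPlaquette d, e ∈ plaquetteEdges p → e' ∉ plaquetteEdges p := by
    intro e he e' he' hne p hep hep'
    exact hF e he e' he' hne (linkPlaqNbr_subset_perturbedNbr supp e (mem_linkPlaqNbr_iff.2 ⟨hne.symm, p, hep, hep'⟩))
  -- the observable
  obtain ⟨hfc, hfb⟩ := continuous_plaquetteSum_and_abs_le (d := d) ρ hρc hρu P
  have hfm : Measurable fun U : LGConfig d (SUN N) => ∑ p ∈ P, plaquetteObs ρ p.1 p.2.1.1 p.2.1.2 U := hfc.measurable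
  -- Step 1: inverse Efron–Stein
  have h1 := sum_dirichlet_le_variance hloc hinv hfm hfb F
    (fun e he e' he' hne U y z => plaquetteSum_update_update_sub ρ P (hsepP e he e' he' hne) U y z)
    (fun e he e' he' hne U y => hcongr e e' (Or.inr (hF e he e' he' hne)) U y)
  -- Step 2: each Dirichlet form ≥ e^{−D} e^{−D} V₀
  have h2 : ∀ e ∈ F, Real.exp (-D) * (Real.exp (-D) * PlaquetteLowerBound.charVariance ρ) ≤
      ∫ U, (∑ p ∈ P, plaquetteObs ρ p.1 p.2.1.1 p.2.1.2 U) *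
        ((∑ p ∈ P, plaquetteObs ρ p.1 p.2.1.1 p.2.1.2 U) - resample q e (fun U => ∑ p ∈ P, plaquetteObs ρ p.1 p.2.1.1 p.2.1.2 U) U) ∂μ := by
    intro e he
    refine le_trans (mul_le_mul_of_nonneg_left ?_ (Real.exp_pos _).le)
      (dirichlet_ge_exp_neg_mul_fibreVariance_of_floor hloc hinv e (haarProbability (SUN N)) (hfloor e) hfm hfb)
    -- a plaquette through `e` and its private link
    obtain ⟨p₀, hp₀⟩ : (plaquettesTouching {e}).Nonempty := by
      obtain ⟨j, hj⟩ : ∃ j : Fin d, j ≠ e.2 := by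
        by_cases h0 : e.2 = ⟨0, by omega⟩
        · exact ⟨⟨1, by omega⟩, fun h => by rw [h0] at h; exact absurd (congrArg Fin.val h) (by norm_num)⟩
        · exact ⟨⟨0, by omega⟩, fun h => h0 h.symm⟩
      rcases lt_or_gt_of_ne hj with hlt | hgt
      · refine ⟨(e.1, ⟨(j, e.2), hlt⟩), mem_plaquettesTouching_singleton.2 ?_⟩
        rw [plaquetteEdges_eq]; simp [plaqLink4]
      · refine ⟨(e.1, ⟨(e.2, j), hgt⟩), mem_plaquettesTouching_singleton.2 ?_⟩
        rw [plaquetteEdges_eq]; simp [plaqLink1]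
    have he₀ : e ∈ plaquetteEdges p₀ := mem_plaquettesTouching_singleton.1 hp₀
    obtain ⟨f, hf, hfe, hstaple⟩ := PlaquetteFirstMoment.exists_resampling_link (G := SUN N) p₀ he₀
    set B : ℝ := P.card * N with hB
    have hj : Measurable fun pr : LGConfig d (SUN N) × SUN N => ∑ p ∈ P, plaquetteObs ρ p.1 p.2.1.1 p.2.1.2 (update pr.1 e pr.2) :=
      hfm.comp measurable_update'
    have hM : Measurable fun U : LGConfig d (SUN N) =>
        ∫ z, ∑ p ∈ P, plaquetteObs ρ p.1 p.2.1.1 p.2.1.2 (update U e z) ∂haarProbability (SUN N) :=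
      (hj.stronglyMeasurable.integral_prod_right' (ν := haarProbability (SUN N))).measurable
    have hsq : Measurable fun pr : LGConfig d (SUN N) × SUN N => ((∑ p ∈ P, plaquetteObs ρ p.1 p.2.1.1 p.2.1.2 (update pr.1 e pr.2)) -
        ∫ z, ∑ p ∈ P, plaquetteObs ρ p.1 p.2.1.1 p.2.1.2 (update pr.1 e z) ∂haarProbability (SUN N)) ^ 2 :=
      (hj.sub (hM.comp measurable_fst)).pow_const 2
    have hgm : Measurable fun U : LGConfig d (SUN N) => ∫ h, ((∑ p ∈ P, plaquetteObs ρ p.1 p.2.1.1 p.2.1.2 (update U e h)) -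
        ∫ z, ∑ p ∈ P, plaquetteObs ρ p.1 p.2.1.1 p.2.1.2 (update U e z) ∂haarProbability (SUN N)) ^ 2 ∂haarProbability (SUN N) :=
      (hsq.stronglyMeasurable.integral_prod_right' (ν := haarProbability (SUN N))).measurable
    have hg0 : ∀ U : LGConfig d (SUN N), 0 ≤ ∫ h, ((∑ p ∈ P, plaquetteObs ρ p.1 p.2.1.1 p.2.1.2 (update U e h)) -
        ∫ z, ∑ p ∈ P, plaquetteObs ρ p.1 p.2.1.1 p.2.1.2 (update U e z) ∂haarProbability (SUN N)) ^ 2 ∂haarProbability (SUN N) :=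
      fun U => integral_nonneg fun h => sq_nonneg _
    have hgB : ∀ U : LGConfig d (SUN N), |∫ h, ((∑ p ∈ P, plaquetteObs ρ p.1 p.2.1.1 p.2.1.2 (update U e h)) -
        ∫ z, ∑ p ∈ P, plaquetteObs ρ p.1 p.2.1.1 p.2.1.2 (update U e z) ∂haarProbability (SUN N)) ^ 2 ∂haarProbability (SUN N)| ≤
        (B + B) ^ 2 := by
      intro U
      have hMb : |∫ z, ∑ p ∈ P, plaquetteObs ρ p.1 p.2.1.1 p.2.1.2 (update U e z) ∂haarProbability (SUN N)| ≤ B :=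
        abs_integral_le_of_abs_le _ fun z => hfb _
      exact abs_integral_le_of_abs_le _ fun h => by
        rw [abs_pow]; exact pow_le_pow_left₀ (abs_nonneg _) ((abs_sub _ _).trans (add_le_add (hfb _) hMb)) 2
    have hres := exp_neg_mul_integral_resample_le_of_floor hinv f (haarProbability (SUN N)) (hfloor f) hgm hgB hg0
    refine le_trans (mul_le_mul_of_nonneg_left ?_ (Real.exp_pos _).le) hres
    calc PlaquetteLowerBound.charVariance ρ = ∫ _U, PlaquetteLowerBound.charVariance ρ ∂μ := by
          rw [integral_const, smul_eq_mul, probReal_univ, one_mul]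
      _ ≤ _ := by
          refine integral_mono_of_nonneg (Filter.Eventually.of_forall fun U => ?_) ?_
            (Filter.Eventually.of_forall fun U => charVariance_le_integral_fibreVariance_zd ρ hρ hN (hP e he) he₀ hf hfe hstaple U)
          · exact (PlaquetteLowerBound.charVariance_pos ρ hρc (by omega)).le
          · exact integrable_of_abs_le_const
              ((hgm.comp measurable_update').stronglyMeasurable.integral_prod_right' (ν := haarProbability (SUN N)))
              fun U => abs_integral_le_of_abs_le _ fun y => hgB _
  -- Step 3: assemble
  have h3 := Finset.sum_le_sum h2
  rw [Finset.sum_const, nsmul_eq_mul] at h3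
  have hexp : Real.exp (-(2 * (4 * ((d : ℝ) - 1) * (N : ℝ) ^ 2 * |β| + ε₀))) = Real.exp (-D) * Real.exp (-D) := by
    rw [← Real.exp_add, hD]; ring_nf
  calc (F.card : ℝ) * Real.exp (-(2 * (4 * ((d : ℝ) - 1) * (N : ℝ) ^ 2 * |β| + ε₀))) * PlaquetteLowerBound.charVariance ρ
      = (F.card : ℝ) * (Real.exp (-D) * (Real.exp (-D) * PlaquetteLowerBound.charVariance ρ)) := by rw [hexp]; ring
    _ ≤ _ := h3
    _ ≤ _ := h1

/-- The same floor for the Mathlib variance. [folklore] -/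
theorem card_mul_le_variance_plaquetteSum_of_memBallZd' (hd : 2 ≤ d) (hN : 2 ≤ N) (hW : MemBallZd ε₀ ε₁ R W supp) {β : ℝ}
    {μ : Measure (LGConfig d (SUN N))} (hμ : μ ∈ perturbedGibbsMeasures (d := d) (fundamentalRep (Fin N)) (N * β) W supp)
    (F : Finset (ZdEdge d)) (hF : ∀ e ∈ F, ∀ e' ∈ F, e ≠ e' → e' ∉ perturbedNbr supp e)
    (P : Finset (ZdPlaquette d)) (hP : ∀ e ∈ F, plaquettesTouching {e} ⊆ P) :
    (F.card : ℝ) * Real.exp (-(2 * (4 * ((d : ℝ) - 1) * (N : ℝ) ^ 2 * |β| + ε₀))) *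
        PlaquetteLowerBound.charVariance (fundamentalRep (Fin N)) ≤
      Var[fun U : LGConfig d (SUN N) => ∑ p ∈ P, plaquetteObs (fundamentalRep (Fin N)) p.1 p.2.1.1 p.2.1.2 U; μ] := by
  have hμ' : IsGibbsMeasure (perturbedYM (d := d) (fundamentalRep (Fin N)) (N * β) W supp) μ := hμ
  haveI := hμ'.isProbabilityMeasure
  have hfm : Measurable fun U : LGConfig d (SUN N) => ∑ p ∈ P, plaquetteObs (fundamentalRep (Fin N)) p.1 p.2.1.1 p.2.1.2 U :=
    (continuous_plaquetteSum_and_abs_le (d := d) (fundamentalRep (Fin N)) (continuous_fundamentalRep (Fin N))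
      fundamentalRep_mem_unitaryGroup P).1.measurable
  rw [variance_eq_integral hfm.aemeasurable]
  exact card_mul_le_variance_plaquetteSum_of_memBallZd hd hN hW hμ F hF P hP

end EnergyVariance

end Summit.Ventures.YMGap.RobustBall
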